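import Summits.Ventures.GridStability.Lyapunov.WSCC9LossySlab7495Roa
import Literature.MathematicalPhysics.PowerSystems.LuriePostnikovSlabInnerBall
import HarnessLib

/-!
# Token «#35‴-BALL» — a CERTIFIED Euclidean inner ball of the «#35‴ LANE-V-7.495°» well
# (the producers' «inner ball r ≈ 0.63°» reading made a kernel statement; lead RULING 8g (5))

For the rider's certificate `WSCC9LossySlab7495.cert` (files `WSCC9LossySlab7495{Data,,Roa}.lean`) on
`M′ = WSCC9.lurieSystem`: with toolchain B's `t_W = 939581/2²⁰` (`inner_ball.t_W` of
`cert/B/slab/lossy/lanev7495/WSCC9LOSSY-slab-u131o2000-e6-tree7-well-eps-CLARABELT-m1e-7.json`, file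
`44a199a298d0bbbd`) and `ϱ = c/t_W = 733899988290788352/6036530721078212890625` (`r2_rk`, exact;
`t_W·ϱ = c` on the nose, `√ϱ ≈ 0.01103 rad ≈ 0.632°`), the kernel decides `t_W·1 − (P + Cᵀ·diag(λ_k b_k)·C) ⪰ 0`
(5 × 5 `LDLᵀ`, in-kernel from the rider's literals and lane V's `CQ` BY NAME — no producer certificate),
`t_W·ϱ ≤ c` and `(C_kᵀC_k)·ϱ < γ_lo²` on all nine channels, and lit-6's `SlabCertificate.ball_subset_well`
(`LuriePostnikovSlabInnerBall.lean`) gives: the Euclidean ball `{x : xᵀx ≤ ϱ}` of Lur'e states lies inside the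
certified well `{x ∈ slab(2·arctan(131/2000)) : V x ≤ c}`; hence (`lossy_slab_roa_of_ball`) every solution of
the printed-lossy WSCC9 classical model whose Lur'e state `x(0) = (ω | σ − σ*)` has `|x(0)|² ≤ ϱ` keeps the
slab and the level for all `t ≥ 0` and has `x(t) → 0`.

THREE COLUMNS. CERTIFIED (kernel): the inclusion `{xᵀx ≤ ϱ} ⊆ well` and the region sentence for that ball,
for the MODEL M′ (as ★ #35 / «#35‴»: Kron-reduced WSCC9 post-fault-B WITH transfer conductances, printed
damping), CLASS = the rider's slab + Popov certificate; inner estimate of an inner estimate (sufficient, not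
sharp). VALIDATED: sos-2's float radius print `r_rk ≈ 0.632°` (now superseded by the kernel inclusion with
the SAME `ϱ`). MODELLED: as ★ #35. No sentence of this file says a grid is stable.
[cite: Khalil2002, Theorem 4.10 (hypothesis (4.25)); VuTuritsyn2017, §4.3 Theorem 1 (set ℛ); Pai1981, §2.16 Theorem [18] eq. (2.63)]
-/

noncomputable section

open Real Set Filter Matrix
open scoped Topology
open Literature.MathematicalPhysics.PowerSystems
open Literature.MathematicalPhysics.PowerSystems.LyapunovFunctionFamily
open Literature.Computation.Certificates
open Summit.Ventures.GridStability.Models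
open Summit.Ventures.GridStability.Lyapunov.WSCC9LossySlab (e1 eκ CQ C_eq)

namespace Summit.Ventures.GridStability.Lyapunov.WSCC9LossySlab7495

/-! ### The two new literals and the kernel decisions -/

/-- Toolchain B's `t_W = 939581/2²⁰` (`V ≤ t_W·|x|²` on the slab). -/
def tWQ : ℚ := (939581 : ℚ) / 1048576

/-- The ball's radius² `ϱ = c/t_W` (exact; `= r2_rk` of the producer's JSON). -/
def rhoQ : ℚ := (733899988290788352 : ℚ) / 6036530721078212890625

/-- The upper comparison matrix over `ℚ` on the typed state index: `P + Cᵀ·diag(λ_k b_k)·C`. -/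
def UQ : Matrix (Fin 3 ⊕ Fin 2) (Fin 3 ⊕ Fin 2) ℚ :=
  PQ + CQᵀ * Matrix.diagonal (fun k => lamK k * bK k) * CQ

set_option maxHeartbeats 4000000 in
/-- **`t_W·1 − (P + Cᵀ·diag(λb)·C) ⪰ 0`** (5 × 5 `LDLᵀ`, decided in the kernel). -/
theorem tW_ldl : PSD.LDLCert ((tWQ • (1 : Matrix (Fin 3 ⊕ Fin 2) (Fin 3 ⊕ Fin 2) ℚ) - UQ).submatrix
    e1.symm e1.symm) := by
  decide +kernel

/-- The scalar ball tests: `t_W ≥ 0`, `t_W·ϱ ≤ c`, and `(C_kᵀC_k)·ϱ < γ_lo²` on every channel. -/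
theorem ball_tests : 0 ≤ tWQ ∧ tWQ * rhoQ ≤ cQ ∧
    ∀ k : Fin 3 × Fin 3, (CQ k ⬝ᵥ CQ k) * rhoQ < gammaLoQ ^ 2 := by
  refine ⟨by norm_num [tWQ], by norm_num [tWQ, rhoQ, cQ], ?_⟩
  decide +kernel

/-! ### Casts -/

/-- `(M·N) ↦ ℝ` (plumbing). -/
private theorem map_mul' {m n o : Type*} [Fintype n] (M : Matrix m n ℚ) (N : Matrix n o ℚ) :
    (M * N).map (Rat.cast : ℚ → ℝ) = M.map (Rat.cast : ℚ → ℝ) * N.map (Rat.cast : ℚ → ℝ) :=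
  Matrix.map_mul (f := Rat.castHom ℝ)
/-- `(M+N) ↦ ℝ` (plumbing). -/
private theorem map_add' {m n : Type*} (M N : Matrix m n ℚ) :
    (M + N).map (Rat.cast : ℚ → ℝ) = M.map (Rat.cast : ℚ → ℝ) + N.map (Rat.cast : ℚ → ℝ) := by
  ext i j; simp
/-- `(M−N) ↦ ℝ` (plumbing). -/
private theorem map_sub' {m n : Type*} (M N : Matrix m n ℚ) :
    (M - N).map (Rat.cast : ℚ → ℝ) = M.map (Rat.cast : ℚ → ℝ) - N.map (Rat.cast : ℚ → ℝ) := by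
  ext i j; simp
/-- transpose commutes with the cast (plumbing). -/
private theorem map_transpose' {m n : Type*} (M : Matrix m n ℚ) :
    Mᵀ.map (Rat.cast : ℚ → ℝ) = (M.map (Rat.cast : ℚ → ℝ))ᵀ := rfl
/-- `diag(d) ↦ ℝ` (plumbing). -/
private theorem map_diagonal' {n : Type*} [DecidableEq n] (d : n → ℚ) :
    (Matrix.diagonal d).map (Rat.cast : ℚ → ℝ) = Matrix.diagonal (fun i => (d i : ℝ)) :=
  Matrix.diagonal_map Rat.cast_zero
/-- `(q·1) ↦ ℝ` (plumbing). -/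
private theorem map_smul_one' {n : Type*} [DecidableEq n] (q : ℚ) :
    (q • (1 : Matrix n n ℚ)).map (Rat.cast : ℚ → ℝ) = (q : ℝ) • (1 : Matrix n n ℝ) := by
  ext i j
  by_cases h : i = j
  · subst h; simp
  · simp [h]

/-- **The certificate's upper comparison matrix IS `UQ ↦ ℝ`.** -/
theorem upperMatrix_eq : cert.upperMatrix = UQ.map (Rat.cast : ℚ → ℝ) := by
  have hd : Matrix.diagonal (fun k => cert.lam k * cert.b k)
      = (Matrix.diagonal (fun k => lamK k * bK k)).map (Rat.cast : ℚ → ℝ) := by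
    rw [map_diagonal', cert_lam, cert_b]; congr 1; funext k; simp only [lam, b]; push_cast; ring
  rw [SlabCertificate.upperMatrix_def, hd, cert_P, C_eq, P, UQ]
  simp only [map_add', map_mul', map_transpose']

/-- **`t_W·1 − upperMatrix ⪰ 0`** over `ℝ` (the kernel fact `tW_ldl`, cast and reindexed). -/
theorem tW_psd : (((tWQ : ℚ) : ℝ) • (1 : Matrix (Fin 3 ⊕ Fin 2) (Fin 3 ⊕ Fin 2) ℝ) - cert.upperMatrix).PosSemidef := by
  have e : ((tWQ : ℚ) : ℝ) • (1 : Matrix (Fin 3 ⊕ Fin 2) (Fin 3 ⊕ Fin 2) ℝ) - cert.upperMatrix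
      = (tWQ • (1 : Matrix (Fin 3 ⊕ Fin 2) (Fin 3 ⊕ Fin 2) ℚ) - UQ).map (Rat.cast : ℚ → ℝ) := by
    rw [upperMatrix_eq, map_sub', map_smul_one']
  rw [e]
  have h := (tW_ldl.posSemidef (R := ℝ)).submatrix e1
  have e2 : (((tWQ • (1 : Matrix (Fin 3 ⊕ Fin 2) (Fin 3 ⊕ Fin 2) ℚ) - UQ).submatrix ⇑e1.symm ⇑e1.symm).map
      (Rat.cast : ℚ → ℝ)).submatrix e1 e1 = (tWQ • (1 : Matrix (Fin 3 ⊕ Fin 2) (Fin 3 ⊕ Fin 2) ℚ) - UQ).map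
      (Rat.cast : ℚ → ℝ) := by
    ext i j; simp
  rwa [e2] at h

/-- The window is positive: `0 < 2·arctan(131/2000)`. -/
theorem window_pos : (0 : ℝ) < 2 * Real.arctan (131 / 2000) :=
  mul_pos two_pos (Real.arctan_pos.2 (by norm_num))

/-- `γ_lo < 2·arctan(131/2000)` (from file 1's `gammaLo_test`). -/
theorem gammaLo_lt_window : ((gammaLoQ : ℚ) : ℝ) < 2 * Real.arctan (131 / 2000) := by
  rw [← γ_eq]
  have h := gammaLo_test
  have h0 : (0 : ℝ) ≤ ((gammaLoQ : ℚ) : ℝ) := by exact_mod_cast h.1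
  have hu : (0 : ℝ) < ((uQ : ℚ) : ℝ) := by exact_mod_cast uQ_pos_lt.1
  have h2 : ((gammaLoQ : ℚ) : ℝ) ^ 2 * (1 + ((uQ : ℚ) : ℝ) ^ 2) ≤ 4 * ((uQ : ℚ) : ℝ) ^ 2 := by
    exact_mod_cast h.2
  exact StructurePreserving.lt_two_arctan_of_sq_le hu h0 h2

/-- The channel norms are the casts of the `ℚ` ones: `C_k ⬝ C_k = (CQ_k ⬝ CQ_k) ↦ ℝ`. -/
theorem channel_norm_eq (k : Fin 3 × Fin 3) :
    WSCC9.lurieSystem.C k ⬝ᵥ WSCC9.lurieSystem.C k = (((CQ k ⬝ᵥ CQ k : ℚ)) : ℝ) := by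
  rw [C_eq]
  simp [dotProduct, Matrix.map_apply, Rat.cast_sum, Rat.cast_mul]

/-! ### THE CERTIFIED INNER BALL and its sentence -/

/-- **Token «#35‴-BALL»: the Euclidean ball `{xᵀx ≤ ϱ}`, `ϱ = 733899988290788352/6036530721078212890625`
(`√ϱ ≈ 0.632°`), lies inside the certified well of «#35‴»** — kernel inclusion by lit-6's
`SlabCertificate.ball_subset_well` from `tW_psd`, the rider's `hsec`, and the decided `ball_tests`.
[cite: Khalil2002, Theorem 4.10 (hypothesis (4.25)); VuTuritsyn2017, §4.3 Theorem 1 (set ℛ)] -/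
theorem ball_subset_well_7495 :
    {x : Fin 3 ⊕ Fin 2 → ℝ | x ⬝ᵥ x ≤ ((rhoQ : ℚ) : ℝ)} ⊆
      {x | x ∈ WSCC9.lurieSystem.slab (fun _ => 2 * Real.arctan (131 / 2000)) ∧ cert.V x ≤ ((cQ : ℚ) : ℝ)} := by
  obtain ⟨ht0, htc, hCk⟩ := ball_tests
  refine cert.ball_subset_well (γ := fun _ => 2 * Real.arctan (131 / 2000)) (fun _ => window_pos)
    (by exact_mod_cast ht0) tW_psd hsec (by exact_mod_cast htc) fun k => ?_
  rw [channel_norm_eq]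
  have h1 : (((CQ k ⬝ᵥ CQ k : ℚ)) : ℝ) * ((rhoQ : ℚ) : ℝ) < ((gammaLoQ : ℚ) : ℝ) ^ 2 := by
    exact_mod_cast hCk k
  have h0 : (0 : ℝ) ≤ ((gammaLoQ : ℚ) : ℝ) := by exact_mod_cast gammaLo_test.1
  have h2 : ((gammaLoQ : ℚ) : ℝ) ^ 2 < (2 * Real.arctan (131 / 2000)) ^ 2 :=
    pow_lt_pow_left₀ gammaLo_lt_window h0 two_ne_zero
  exact h1.trans h2

/-- **THE SENTENCE FOR THE BALL.** For every solution `c` of M′ = `WSCC9.postB_SPdamp.toModel` (Kron-reduced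
WSCC9 post-fault-B classical model WITH transfer conductances, printed damping) whose Lur'e state
`x(0) = (ω | σ − σ*)` satisfies `x(0)ᵀx(0) ≤ ϱ` (`√ϱ ≈ 0.01103 rad ≈ 0.632°` Euclidean over the five state
deviations): the slab `|σ_k − δ*_k| < 2·arctan(131/2000)` and the level `V ≤ c` hold for all `t ≥ 0` and
`x(t) → 0`. CERTIFIED for the MODEL; a Euclidean inner ball of an inner estimate. No sentence here says a
grid is stable. [cite: Pai1981, §2.16 Theorem [18] eqs. (2.63)–(2.64); VuTuritsyn2017, §4.3 Theorem 1; Khalil2002, Theorem 4.10] -/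
theorem lossy_slab_roa_of_ball {c : ℝ → ClassicalSwing.State 3}
    (hc : WSCC9.postB_SPdamp.toModel.IsSolutionOn c univ)
    (h0 : WSCC9.postB_SPdamp.lurieState WSCC9.postB_SPdamp.angleOf (c 0)
            ⬝ᵥ WSCC9.postB_SPdamp.lurieState WSCC9.postB_SPdamp.angleOf (c 0) ≤ ((rhoQ : ℚ) : ℝ)) :
    (∀ t, 0 ≤ t →
        WSCC9.postB_SPdamp.lurieState WSCC9.postB_SPdamp.angleOf (c t)
            ∈ WSCC9.lurieSystem.slab (fun _ => 2 * Real.arctan (131 / 2000)) ∧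
          cert.V (WSCC9.postB_SPdamp.lurieState WSCC9.postB_SPdamp.angleOf (c t)) ≤ ((cQ : ℚ) : ℝ)) ∧
      Tendsto (fun t => WSCC9.postB_SPdamp.lurieState WSCC9.postB_SPdamp.angleOf (c t)) atTop (𝓝 0) := by
  have hw := ball_subset_well_7495 h0
  exact lossy_slab_roa hc hw.1 hw.2

end Summit.Ventures.GridStability.Lyapunov.WSCC9LossySlab7495

end
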